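import Summits.CriticalPhenomena.PercolationContinuityZ3.Theorems.PercNearOneGluingNoHeavyLowerTailCILTwoPortLevelTwo
import Summits.CriticalPhenomena.PercolationContinuityZ3.Theorems.PercNearOneGluingNoHeavyLowerTailCILTwoPendantStars
import Summits.CriticalPhenomena.PercolationContinuityZ3.Theorems.PercNearOneGluingNoHeavyLowerTailPendantStripping
import Summits.CriticalPhenomena.PercolationContinuityZ3.Theorems.PercNearOneGluingNoHeavyLowerTailCILOwnEdgeStability
import Summits.CriticalPhenomena.PercolationContinuityZ3.Theorems.PercNearOneGluingAdditiveGluingOneBond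
import HarnessLib

/-!
# `NoHeavyLowerTail` (stmt-CriticalPhenomena-4575) — TPS and CIL for the two-pendant-stars observer when one star has two ports (`j ≤ 2`)

Support file (prover `prim-hp-2`, deletion–contraction / pivotal-edge line; `--supports stmt-CriticalPhenomena-4575`).
No definitions, no named facts, no sorries.

`…CILTwoPendantStars` (`cil_twoPendantStars_of_TPS`) reduces the cumulative isolation lemma at an observer `o` with two light
pendant relay-stars `s₁, s₂` to the two-pendant-stars inequality TPS = `CS_{w_o}({s₁,s₂}, q)` for the `H`-champion `q`
(`H = G − o`, weights `w_o`).  `…CILTwoPortLevelTwo` (`setCS_pair_twoPort_levelTwo`) proves it for `j ≤ 2` when `s₂` has two ports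
`c, d` and `q ∉ {c, d}`.  This file removes the last proviso and assembles:

* `tps_twoPort_of_witnessPort` — if the champion `q` IS a port of the two-port star (`q = c`): pivot on the pair `s₂–c`
  (`stub_oneBondDecomp_k15`); the glued branch carries no mass of either event (`c ↔ s₂`), the deleted branch is a star `s₂` pendant on
  `d`, stripped by `CutObserver.setCS_of_pendantMember` (prover `prim-hp-6`) down to CIL at `s₁` with witness `c`
  (`cil_of_portDomination` + `SubStar.setCS_singleton_of_cil`); the champion survives the deletion of its own pair
  (`CutObserver.champion_of_erase_own_edge`) and the pendant law is `Hyperedge.lightness_eq_of_sameGlue` with glue probability `0`.  Any `j`.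
* `tps_twoPort_levelTwo` — **TPS for `j ≤ 2` whenever `s₂` has exactly two ports**, for every champion `q` of `A`.
* `cil_twoPendantStars_twoPort_levelTwo` — **CIL (`stub_cumulativeIsolation` of crux `NoHeavyLowerTail`) at every observer `o ∉ A`
  whose positive-weight neighbours are relays and two non-adjacent pendant relay-stars `s₁, s₂`, one of which has exactly two ports,
  at levels `j ≤ 2`** — witness the `H`-champion.  This is the `(5,2)` rung of the first open class of the hull-port residual
  (crux notes of prim-hp-2, TPS-P2EQ2.md; lead memo LEAD-GEN2) for these port shapes.
-/

noncomputable section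

namespace Summit.CriticalPhenomena.PercolationContinuityZ3.Theorems

open MeasureTheory Set Literature.Probability.LatticeModels Literature.Probability.Percolation
open scoped Classical BigOperators

variable {n : ℕ}

open CutObserver KNPreFKG Hyperedge SubStar TwoPendantStars in
/-- **TPS when the witness is a port of the two-port star.**  `s₁ ≠ s₂` non-relays, the positive-weight pairs at `s₁` end in relays
(and there is one), those at `s₂` end in `c` or `d` (relays, `c ≠ d`), and `c` is a champion of `A` in `w`.  Then `CS_w({s₁,s₂}, c)`.
Any level `j`. [cite: VandenbergHaggstromKahn2005, Thm. 1.5 (p. 7) — via `CutObserver.setCS_of_pendantMember` and `cil_of_portDomination`] -/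
theorem tps_twoPort_of_witnessPort (w : Sym2 (Fin n) → unitInterval) (A : Finset (Fin n)) (s₁ s₂ c d : Fin n) (j : ℕ)
    (hs₁A : s₁ ∉ A) (hs₂A : s₂ ∉ A) (h12 : s₁ ≠ s₂) (hcA : c ∈ A) (hdA : d ∈ A) (hcd : c ≠ d)
    (hobs₁ : ∀ v, w s(s₁, v) ≠ 0 → v ∈ A) (hne₁ : ∃ v, w s(s₁, v) ≠ 0)
    (hobs₂ : ∀ v, v ≠ s₂ → w s(s₂, v) ≠ 0 → v = c ∨ v = d)
    (hchamp : ∀ a ∈ A, (prodBernoulli w).real {ω : BondConfig (Fin n) | (A.filter fun z => ω ∈ openConn a z).card ≤ j} ≤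
      (prodBernoulli w).real {ω : BondConfig (Fin n) | (A.filter fun z => ω ∈ openConn c z).card ≤ j}) :
    (prodBernoulli w).real {ω : BondConfig (Fin n) | (∀ x ∈ ({s₁, s₂} : Finset (Fin n)), ω ∉ openConn c x) ∧
        1 ≤ (A.filter fun z => ∃ x ∈ ({s₁, s₂} : Finset (Fin n)), ω ∈ openConn x z).card ∧
        (A.filter fun z => ∃ x ∈ ({s₁, s₂} : Finset (Fin n)), ω ∈ openConn x z).card ≤ j} ≤
      (prodBernoulli w).real {ω : BondConfig (Fin n) | (∀ x ∈ ({s₁, s₂} : Finset (Fin n)), ω ∉ openConn c x) ∧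
        (A.filter fun z => ω ∈ openConn c z).card ≤ j} := by
  haveI : ∀ u : Sym2 (Fin n) → unitInterval, IsProbabilityMeasure (prodBernoulli u) := fun u => inferInstance
  have hcs : c ≠ s₂ := fun h => hs₂A (h ▸ hcA)
  have hds : d ≠ s₂ := fun h => hs₂A (h ▸ hdA)
  have hc1 : c ≠ s₁ := fun h => hs₁A (h ▸ hcA)
  set e : Sym2 (Fin n) := s(c, s₂) with he
  have hee : s(s₂, c) = e := Sym2.eq_swap
  set LS := {ω : BondConfig (Fin n) | (∀ x ∈ ({s₁, s₂} : Finset (Fin n)), ω ∉ openConn c x) ∧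
    1 ≤ (A.filter fun z => ∃ x ∈ ({s₁, s₂} : Finset (Fin n)), ω ∈ openConn x z).card ∧
    (A.filter fun z => ∃ x ∈ ({s₁, s₂} : Finset (Fin n)), ω ∈ openConn x z).card ≤ j} with hLS
  set RS := {ω : BondConfig (Fin n) | (∀ x ∈ ({s₁, s₂} : Finset (Fin n)), ω ∉ openConn c x) ∧
    (A.filter fun z => ω ∈ openConn c z).card ≤ j} with hRS
  -- both events force the pair `c–s₂` closed
  have hsub : ∀ ω : BondConfig (Fin n), (∀ x ∈ ({s₁, s₂} : Finset (Fin n)), ω ∉ openConn c x) → e ∉ ω := by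
    intro ω h hopen
    have hadj : (openGraph ω).Adj c s₂ := by rw [openGraph, SimpleGraph.fromEdgeSet_adj]; exact ⟨hopen, hcs⟩
    exact h s₂ (by simp) hadj.reachable
  have hnull : ∀ S : Set (BondConfig (Fin n)), (∀ ω ∈ S, e ∉ ω) →
      (prodBernoulli (Function.update w e 1)).real S = 0 := by
    intro S hS
    refine le_antisymm ?_ measureReal_nonneg
    calc (prodBernoulli (Function.update w e 1)).real S
        ≤ (prodBernoulli (Function.update w e 1)).real {ω : BondConfig (Fin n) | e ∉ ω} :=
          measureReal_mono (fun ω hω => hS ω hω) (measure_ne_top _ _)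
      _ = 0 := by rw [prodBernoulli_real_setOf_notMem, Function.update_self]; simp
  have hL1 : (prodBernoulli (Function.update w e 1)).real LS = 0 := hnull LS fun ω hω => hsub ω hω.1
  have hR1 : (prodBernoulli (Function.update w e 1)).real RS = 0 := hnull RS fun ω hω => hsub ω hω.1
  have hdecL := stub_oneBondDecomp_k15 n w e LS
  have hdecR := stub_oneBondDecomp_k15 n w e RS
  rw [hL1] at hdecL
  rw [hR1] at hdecR
  -- the deleted branch `w₀ = w[e ↦ 0]`: `s₂` pendant on `d`
  set w₀ : Sym2 (Fin n) → unitInterval := Function.update w e 0 with hw₀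
  have hy0 : 0 ≤ 1 - (w e : ℝ) := sub_nonneg.2 (w e).2.2
  by_cases hy1 : (w e : ℝ) < 1
  swap
  · -- `w e = 1`: the pair `c–s₂` is almost surely open and the left event is null
    have hwe : (w e : ℝ) = 1 := le_antisymm (w e).2.2 (not_lt.1 hy1)
    rw [hdecL, hwe]
    have : 0 ≤ (prodBernoulli w).real RS := measureReal_nonneg
    linarith
  · suffices h0 : (prodBernoulli w₀).real LS ≤ (prodBernoulli w₀).real RS by
      rw [hdecL, hdecR]
      have := mul_le_mul_of_nonneg_left h0 hy0
      linarith
    have hw₀e : w₀ e = 0 := by rw [hw₀, Function.update_self]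
    have hw₀_ne : ∀ f : Sym2 (Fin n), f ≠ e → w₀ f = w f := fun f hf => by rw [hw₀, Function.update_of_ne hf]
    -- champion survives deleting its own pair
    have hchamp₀ := champion_of_erase_own_edge w A c s₂ j hcs hy1 hchamp
    -- two-port structure of `w₀` and of `w₀ ∖ s₂`
    have hobs₀ : ∀ y, y ≠ s₂ → w₀ s(s₂, y) ≠ 0 → y = c ∨ y = d := by
      intro y hy h
      by_cases hyc : y = c
      · exact Or.inl hyc
      rw [hw₀_ne _ (fun h' => hyc (by rw [← hee] at h'; exact Sym2.congr_right.1 h'))] at h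
      exact hobs₂ y hy h
    set w₀' : Sym2 (Fin n) → unitInterval := fun f => if f ∈ {f : Sym2 (Fin n) | s₂ ∉ f} then w₀ f else 0 with hw₀'
    have hw₀'z : ∀ y, w₀' s(s₂, y) = 0 := by
      intro y
      have : ¬ (s₂ ∉ s(s₂, y)) := fun h => h (Sym2.mem_mk_left _ _)
      simp only [hw₀', mem_setOf_eq, this, if_false]
    have hobs₀' : ∀ y, y ≠ s₂ → w₀' s(s₂, y) ≠ 0 → y = c ∨ y = d := fun y _ h => absurd (hw₀'z y) h
    have hoff' : ∀ f : Sym2 (Fin n), s₂ ∉ f → w₀ f = w₀' f := by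
      intro f hf; simp only [hw₀', mem_setOf_eq, hf, not_false_eq_true, if_true]
    have hglue' : (w₀ s(s₂, c) : ℝ) * w₀ s(s₂, d) = (w₀' s(s₂, c) : ℝ) * w₀' s(s₂, d) := by
      rw [hw₀'z c, hw₀'z d, hee, hw₀e]; simp
    have hsame : ∀ x ∈ A, (prodBernoulli w₀).real {ω : BondConfig (Fin n) | (A.filter fun z => ω ∈ openConn x z).card ≤ j} =
        (prodBernoulli w₀').real {ω : BondConfig (Fin n) | (A.filter fun z => ω ∈ openConn x z).card ≤ j} :=
      fun x hx => lightness_eq_of_sameGlue w₀ w₀' A s₂ c d x j hs₂A hx hcs hds hcd hobs₀ hobs₀' hoff' hglue'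
    -- `s₂` is pendant on `d` in `w₀`
    have hiso : ∀ u, u ≠ s₂ → u ≠ d → w₀ s(s₂, u) = 0 := by
      intro u hu hud
      by_cases huc : u = c
      · subst huc; rw [hee]; exact hw₀e
      · rw [hw₀_ne _ (fun h' => huc (by rw [← hee] at h'; exact Sym2.congr_right.1 h'))]
        by_contra h
        rcases hobs₂ u hu h with h' | h'
        · exact huc h'
        · exact hud h'
    have hdom_d : (prodBernoulli w₀').real {ω : BondConfig (Fin n) | (A.filter fun z => ω ∈ openConn d z).card ≤ j} ≤
        (prodBernoulli w₀').real {ω : BondConfig (Fin n) | (A.filter fun z => ω ∈ openConn c z).card ≤ j} := by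
      rw [← hsame d hdA, ← hsame c hcA]; exact hchamp₀ d hdA
    -- CIL at `s₁` with witness `c` in `w₀ ∖ s₂` (ports of `s₁` dominated by the champion)
    set P : Finset (Fin n) := A.filter fun v => w s(s₁, v) ≠ 0 with hP
    have hPne : P.Nonempty := by
      obtain ⟨v, hv⟩ := hne₁
      exact ⟨v, Finset.mem_filter.2 ⟨hobs₁ v hv, hv⟩⟩
    set m : ℕ := P.card with hm
    have hmpos : 0 < m := Finset.card_pos.2 hPne
    let p : Fin m → Fin n := fun l => ((P.equivFin.symm l) : Fin n)
    have hp : Function.Injective p := fun l l' h => P.equivFin.symm.injective (Subtype.ext h)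
    have hpP : ∀ l, p l ∈ P := fun l => (P.equivFin.symm l).2
    have hpA : ∀ l, p l ∈ A := fun l => (Finset.mem_filter.1 (hpP l)).1
    have hobs₁' : ∀ v, w₀' s(s₁, v) ≠ 0 → ∃ l, v = p l := by
      intro v hv
      have hv2 : s₂ ∉ s(s₁, v) := by
        intro h; apply hv; simp only [hw₀', mem_setOf_eq, h, not_true_eq_false, if_false]
      have h1 : w₀ s(s₁, v) ≠ 0 := by rwa [hoff' _ hv2]
      have h2 : s(s₁, v) ≠ e := fun h => hv2 (h ▸ Sym2.mem_mk_right c s₂)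
      rw [hw₀_ne _ h2] at h1
      have hvP : v ∈ P := Finset.mem_filter.2 ⟨hobs₁ v h1, h1⟩
      exact ⟨P.equivFin ⟨v, hvP⟩, by show v = ((P.equivFin.symm (P.equivFin ⟨v, hvP⟩)) : Fin n); rw [Equiv.symm_apply_apply]⟩
    have hdomP : ∀ l : Fin m,
        (prodBernoulli w₀').real {ω : BondConfig (Fin n) | (A.filter fun z => ω ∈ openConn (p l) z).card ≤ j} ≤
          (prodBernoulli w₀').real {ω : BondConfig (Fin n) | (A.filter fun z => ω ∈ openConn c z).card ≤ j} := by
      intro l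
      rw [← hsame (p l) (hpA l), ← hsame c hcA]; exact hchamp₀ (p l) (hpA l)
    have hcil := cil_of_portDomination w₀' A s₁ j p hp hpA hs₁A hmpos hobs₁' c hdomP
    have hrest := setCS_singleton_of_cil w₀' A s₁ c j hcA hcil
    have herase : ({s₁, s₂} : Finset (Fin n)).erase s₂ = {s₁} := by
      ext x
      simp only [Finset.mem_erase, Finset.mem_insert, Finset.mem_singleton]
      constructor
      · rintro ⟨hne, h | h⟩
        · exact h
        · exact absurd h hne
      · intro h; exact ⟨h ▸ h12, Or.inl h⟩
    have hpend := setCS_of_pendantMember w₀ A ({s₁, s₂} : Finset (Fin n)) c s₂ d j (by simp) hs₂A hds hcs hiso hdom_d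
      (by rw [herase]; exact hrest)
    exact hpend

open CutObserver in
/-- **TPS at levels `j ≤ 2` when one star has exactly two ports.**  `s₁ ≠ s₂` non-relays; the positive-weight pairs at `s₁` end in
relays (at least one), those at `s₂` in `c` or `d` (relays, `c ≠ d`); `q` a champion of `A` in `w`; `j ≤ 2`.  Then `CS_w({s₁,s₂}, q)`.
(`q ∉ {c,d}`: `setCS_pair_twoPort_levelTwo`; `q ∈ {c,d}`: `tps_twoPort_of_witnessPort`.)
[cite: VandenbergHaggstromKahn2005, Thm. 1.5 (p. 7)] -/
theorem tps_twoPort_levelTwo (w : Sym2 (Fin n) → unitInterval) (A : Finset (Fin n)) (s₁ s₂ c d q : Fin n) (j : ℕ)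
    (hj : j ≤ 2) (hs₁A : s₁ ∉ A) (hs₂A : s₂ ∉ A) (h12 : s₁ ≠ s₂) (hcA : c ∈ A) (hdA : d ∈ A) (hcd : c ≠ d) (hqA : q ∈ A)
    (hobs₁ : ∀ v, w s(s₁, v) ≠ 0 → v ∈ A) (hne₁ : ∃ v, w s(s₁, v) ≠ 0)
    (hobs₂ : ∀ v, v ≠ s₂ → w s(s₂, v) ≠ 0 → v = c ∨ v = d)
    (hchamp : ∀ a ∈ A, (prodBernoulli w).real {ω : BondConfig (Fin n) | (A.filter fun z => ω ∈ openConn a z).card ≤ j} ≤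
      (prodBernoulli w).real {ω : BondConfig (Fin n) | (A.filter fun z => ω ∈ openConn q z).card ≤ j}) :
    (prodBernoulli w).real {ω : BondConfig (Fin n) | (∀ x ∈ ({s₁, s₂} : Finset (Fin n)), ω ∉ openConn q x) ∧
        1 ≤ (A.filter fun z => ∃ x ∈ ({s₁, s₂} : Finset (Fin n)), ω ∈ openConn x z).card ∧
        (A.filter fun z => ∃ x ∈ ({s₁, s₂} : Finset (Fin n)), ω ∈ openConn x z).card ≤ j} ≤
      (prodBernoulli w).real {ω : BondConfig (Fin n) | (∀ x ∈ ({s₁, s₂} : Finset (Fin n)), ω ∉ openConn q x) ∧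
        (A.filter fun z => ω ∈ openConn q z).card ≤ j} := by
  by_cases hqc : q = c
  · subst hqc
    exact tps_twoPort_of_witnessPort w A s₁ s₂ q d j hs₁A hs₂A h12 hqA hdA hcd hobs₁ hne₁ hobs₂ hchamp
  by_cases hqd : q = d
  · subst hqd
    exact tps_twoPort_of_witnessPort w A s₁ s₂ q c j hs₁A hs₂A h12 hqA hcA (Ne.symm hcd) hobs₁ hne₁
      (fun v hv h => (hobs₂ v hv h).symm) hchamp
  exact setCS_pair_twoPort_levelTwo w A s₁ s₂ c d q j hj hs₁A hs₂A h12 hcA hdA hcd hqA hqc hqd hobs₁ hobs₂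
    (fun a ha _ => hchamp a ha)

open CutObserver SubStar TwoPendantStars in
/-- **CIL for the two-pendant-stars observer when one star has two ports, `j ≤ 2`.**  Let `o ∉ A` have positive-weight neighbours
only among the relays and two non-relays `s₁ ≠ s₂`; apart from `o`, `s₁` has only relay neighbours (at least one) and `s₂` has only
relay neighbours, all among `c ≠ d` (two ports); let `q ∈ A` be an `H`-champion (`H` = no edge at `o`) and `j ≤ 2`.  Then
`μ_w{1 ≤ N ≤ j} ≤ μ_w{|π(q)| ≤ j}` — the conclusion of `stub_cumulativeIsolation` (crux `NoHeavyLowerTail`, stmt-CriticalPhenomena-4575)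
with the witness `q`.  Proof: `cil_twoPendantStars_of_TPS` (star transfer) + `tps_twoPort_levelTwo` in the weights with the pairs at
`o` switched off. [cite: VandenbergHaggstromKahn2005, Thm. 1.5 (p. 7); KozmaNitzan2024, Lemma 5 (p. 13) — star decomposition] -/
theorem cil_twoPendantStars_twoPort_levelTwo (w : Sym2 (Fin n) → unitInterval) (A : Finset (Fin n)) (o s₁ s₂ c d q : Fin n)
    (j : ℕ) (hj : j ≤ 2) (hoA : o ∉ A) (hs₁A : s₁ ∉ A) (hs₂A : s₂ ∉ A) (hs₁o : s₁ ≠ o) (hs₂o : s₂ ≠ o) (h12 : s₁ ≠ s₂)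
    (hcA : c ∈ A) (hdA : d ∈ A) (hcd : c ≠ d)
    (hobs : ∀ v, w s(o, v) ≠ 0 → v ∈ A ∨ v = s₁ ∨ v = s₂)
    (hobs₁ : ∀ v, v ≠ o → w s(s₁, v) ≠ 0 → v ∈ A) (hobs₂ : ∀ v, v ≠ o → w s(s₂, v) ≠ 0 → v ∈ A)
    (htwo : ∀ v, v ≠ o → v ≠ s₂ → w s(s₂, v) ≠ 0 → v = c ∨ v = d)
    (hne₁ : ∃ v ∈ A, w s(s₁, v) ≠ 0) (hne₂ : ∃ v ∈ A, w s(s₂, v) ≠ 0) (hqA : q ∈ A)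
    (hchamp : ∀ a ∈ A,
      (prodBernoulli w).real {ω : BondConfig (Fin n) |
          (A.filter fun z => (openGraph (ω ∩ {e | o ∉ e})).Reachable a z).card ≤ j} ≤
        (prodBernoulli w).real {ω : BondConfig (Fin n) |
          (A.filter fun z => (openGraph (ω ∩ {e | o ∉ e})).Reachable q z).card ≤ j}) :
    (prodBernoulli w).real {ω : BondConfig (Fin n) |
        1 ≤ (A.filter fun x => ω ∈ openConn o x).card ∧ (A.filter fun x => ω ∈ openConn o x).card ≤ j} ≤
      (prodBernoulli w).real {ω : BondConfig (Fin n) | (A.filter fun x => ω ∈ openConn q x).card ≤ j} := by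
  set wo : Sym2 (Fin n) → unitInterval := fun e => if e ∈ {e : Sym2 (Fin n) | o ∉ e} then w e else 0 with hwo
  have hwo_of : ∀ u v : Fin n, o ∉ s(u, v) → wo s(u, v) = w s(u, v) := by
    intro u v h; simp only [hwo, Set.mem_setOf_eq, h, not_false_eq_true, if_true]
  have hwo_ne : ∀ u v : Fin n, wo s(u, v) ≠ 0 → o ∉ s(u, v) ∧ w s(u, v) ≠ 0 := by
    intro u v h
    by_cases ho : o ∉ s(u, v)
    · exact ⟨ho, by rwa [hwo_of u v ho] at h⟩
    · exfalso; apply h; simp only [hwo, Set.mem_setOf_eq, ho, if_false]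
  have hobs₁' : ∀ v, wo s(s₁, v) ≠ 0 → v ∈ A := by
    intro v hv
    obtain ⟨ho, hw⟩ := hwo_ne s₁ v hv
    exact hobs₁ v (fun h => ho (h ▸ Sym2.mem_mk_right s₁ v)) hw
  have hne₁' : ∃ v, wo s(s₁, v) ≠ 0 := by
    obtain ⟨v, hvA, hv⟩ := hne₁
    refine ⟨v, ?_⟩
    have ho : o ∉ s(s₁, v) := by
      rw [Sym2.mem_iff, not_or]; exact ⟨fun h => hs₁o h.symm, fun h => hoA (h ▸ hvA)⟩
    rw [hwo_of s₁ v ho]; exact hv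
  have hobs₂' : ∀ v, v ≠ s₂ → wo s(s₂, v) ≠ 0 → v = c ∨ v = d := by
    intro v hv2 hv
    obtain ⟨ho, hw⟩ := hwo_ne s₂ v hv
    exact htwo v (fun h => ho (h ▸ Sym2.mem_mk_right s₂ v)) hv2 hw
  have hchamp' : ∀ a ∈ A, (prodBernoulli wo).real {ω : BondConfig (Fin n) | (A.filter fun z => ω ∈ openConn a z).card ≤ j} ≤
      (prodBernoulli wo).real {ω : BondConfig (Fin n) | (A.filter fun z => ω ∈ openConn q z).card ≤ j} := by
    intro a ha
    have h := hchamp a ha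
    rw [real_lightness_avoid w A o a j, real_lightness_avoid w A o q j] at h
    exact h
  have hTPS := tps_twoPort_levelTwo wo A s₁ s₂ c d q j hj hs₁A hs₂A h12 hcA hdA hcd hqA hobs₁' hne₁' hobs₂' hchamp'
  exact cil_twoPendantStars_of_TPS w A o s₁ s₂ q j hoA hs₁A hs₂A hs₁o hs₂o hobs hobs₁ hobs₂ hne₁ hne₂ hqA hchamp hTPS

end Summit.CriticalPhenomena.PercolationContinuityZ3.Theorems

end
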